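import Summits.RiemannHypothesis.RiemannHypothesis.Theorems.WeilWindowFlowWindowLipschitzStubLocalizedCutAux

/-!
# Markov part of Weil's form: a.e. pair rigidity and the energy deficit identity

Support file for item `MarkovPartPositiveGroundState` of route `WeilGroundState`
(`Summits/RiemannHypothesis/RiemannHypothesis/Theses/WeilGroundState.lean`): the Perron–Frobenius
theory of the pole-removed Weil form `Q₀ = 𝓔_a − M_a‖·‖²` (`weilMarkovQuadratic`,
`weilDirichletEnergy`) is done WITHOUT operators, through pointwise identities between increments
`|u(y) − u(x)|²` integrated against the jump measure of `𝓔_a`. Two pieces of bookkeeping used by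
every later step are proved here.

* `ae_pair_eq_zero_of_ae_lintegral_shift` — **a.e. pair rigidity**: if a symmetric non-negative
  measurable kernel `F(x, y)` has `∫ F(x, x + t) dx = 0` for a.e. jump length `t > 0`, then
  `F(x, y) = 0` for a.e. `x` and a.e. `y` (the archimedean jump density of `𝓔_a` charges EVERY
  length `t > 0`, which is the irreducibility behind positivity improvement; Fubini and the shear
  `(x, t) ↦ (x, x + t)`).
* `lintegral_deficit_le` — **the energy deficit**: a pointwise identity
  `|M(y) − M(x)|² + F(x, y) = w₀|Φ₀(y) − Φ₀(x)|² + w₁|Φ₁(y) − Φ₁(x)|²` with `F ≥ 0` integrates to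
  `D_t(M) + ∫ F(x, x+t) dx = w₀ D_t(Φ₀) + w₁ D_t(Φ₁)` and bounds the weighted deficit
  `∫₀^∞ ρ(t) ∫ F(x, x+t) dx dt` by `w₀ 𝓔_a(Φ₀) + w₁ 𝓔_a(Φ₁) − 𝓔_a(M)`.

Measurability of `t ↦ D_t(u)` for `u ∈ L²` is taken from the tree
(`stub_localizedCut_aesm_weilIncrement`, crux toolkit of route WeilWindowFlow).

## References

* M. Reed, B. Simon, *Methods of Modern Mathematical Physics IV* (1978), §XIII.12 (the role of
  positivity improvement); here replaced by the convexity of `ρ ↦ 𝓔(√ρ)` for jump forms.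
* M. Fukushima, Y. Oshima, M. Takeda, *Dirichlet Forms and Symmetric Markov Processes* (2011), §1.4.
-/

-- `Summit.RiemannHypothesis.RiemannHypothesis.…` repeats the summit name by design (D-0017 layout).
set_option linter.dupNamespace false

noncomputable section

open MeasureTheory Set Filter
open scoped Topology ENNReal NNReal ArithmeticFunction.vonMangoldt

namespace Summit.RiemannHypothesis.RiemannHypothesis.Theorems.WeilGroundStateMarkovPart

open Literature.NumberTheory.LFunctions
open Summit.RiemannHypothesis.RiemannHypothesis.Theorems.WeilWindowFlowWindowLipschitz

/-! ## A.e. pair rigidity -/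

/-- Shift symmetry of pair integrals: for a symmetric kernel `F(x, y) = F(y, x)`,
`∫⁻ F(x, x − t) dx = ∫⁻ F(x, x + t) dx` (substitute `x = y + t`). -/
theorem lintegral_shift_neg {F : ℝ → ℝ → ℝ≥0∞} (hsymm : ∀ x y, F x y = F y x) (t : ℝ) :
    ∫⁻ x, F x (x + -t) = ∫⁻ x, F x (x + t) := by
  have h := lintegral_add_right_eq_self (μ := (volume : Measure ℝ)) (fun x ↦ F x (x + -t)) t
  rw [← h]
  refine lintegral_congr fun y ↦ ?_
  rw [show y + t + -t = y by ring, hsymm]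

/-- **A.e. pair rigidity.** Let `F : ℝ → ℝ → ℝ≥0∞` be jointly measurable and symmetric. If for
a.e. jump length `t > 0` the pair integral `∫⁻ F(x, x + t) dx` vanishes, then `F(x, y) = 0` for
a.e. `x` and a.e. `y`. (Symmetry extends the hypothesis to a.e. `t ∈ ℝ`; then Fubini in `(t, x)`
and the translation `y = x + t`.) This is how "the jump density is positive at every length"
(irreducibility of the pure-jump form) is converted into statements about a.e. every pair of
points. -/
theorem ae_pair_eq_zero_of_ae_lintegral_shift {F : ℝ → ℝ → ℝ≥0∞}
    (hF : Measurable (Function.uncurry F)) (hsymm : ∀ x y, F x y = F y x)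
    (h : ∀ᵐ t : ℝ, t ∈ Ioi (0 : ℝ) → ∫⁻ x, F x (x + t) = 0) :
    ∀ᵐ x : ℝ, ∀ᵐ y : ℝ, F x y = 0 := by
  -- measurability of `(t, x) ↦ F x (x + t)`
  have hG : Measurable fun p : ℝ × ℝ ↦ F p.2 (p.2 + p.1) := by
    have : (fun p : ℝ × ℝ ↦ F p.2 (p.2 + p.1)) =
        Function.uncurry F ∘ fun p : ℝ × ℝ ↦ (p.2, p.2 + p.1) := by
      funext p; rfl
    rw [this]
    exact hF.comp (measurable_snd.prodMk (measurable_snd.add measurable_fst))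
  -- extend to a.e. `t` (negative lengths by symmetry, `t = 0` is null)
  have hneg : ∀ᵐ t : ℝ, -t ∈ Ioi (0 : ℝ) → ∫⁻ x, F x (x + t) = 0 := by
    have := (Measure.measurePreserving_neg (volume : Measure ℝ)).quasiMeasurePreserving.ae h
    filter_upwards [this] with t ht hneg
    have h1 := ht hneg
    rwa [lintegral_shift_neg hsymm] at h1
  have hall : ∀ᵐ t : ℝ, ∫⁻ x, F x (x + t) = 0 := by
    filter_upwards [h, hneg, Measure.ae_ne volume (0 : ℝ)] with t h1 h2 h0
    rcases lt_or_gt_of_ne h0 with hlt | hgt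
    · exact h2 (by simpa using hlt)
    · exact h1 hgt
  -- Fubini: for a.e. `t`, a.e. `x`
  have hae : ∀ᵐ t : ℝ, ∀ᵐ x : ℝ, F x (x + t) = 0 := by
    filter_upwards [hall] with t ht
    have hm : Measurable fun x : ℝ ↦ F x (x + t) :=
      hG.comp (measurable_const.prodMk measurable_id)
    exact (lintegral_eq_zero_iff hm).1 ht
  -- swap the quantifiers
  have hswap : ∀ᵐ x : ℝ, ∀ᵐ t : ℝ, F x (x + t) = 0 := by
    have hset : MeasurableSet {p : ℝ × ℝ | F p.2 (p.2 + p.1) = 0} :=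
      hG (measurableSet_singleton 0)
    exact (Measure.ae_ae_comm (μ := (volume : Measure ℝ)) (ν := (volume : Measure ℝ))
      (p := fun t x ↦ F x (x + t) = 0) hset).1 hae
  -- translate `y = x + t`
  filter_upwards [hswap] with x hx
  have := (measurePreserving_sub_right (volume : Measure ℝ) x).quasiMeasurePreserving.ae hx
  filter_upwards [this] with y hy
  simpa using hy

/-- From a vanishing weighted double integral to a.e. vanishing pair integrals: if
`∫⁻_{t>0} ∫⁻ ofReal(ρ(t) F(x, x+t)) dx dt = 0` with the archimedean density `ρ > 0` on `(0, ∞)`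
and `F ≥ 0`, then `∫⁻ ofReal (F(x, x+t)) dx = 0` for a.e. `t > 0`. -/
theorem ae_lintegral_shift_eq_zero {F : ℝ → ℝ → ℝ} (hF : Measurable (Function.uncurry F))
    (hF0 : ∀ x y, 0 ≤ F x y)
    (h : ∫⁻ t in Ioi (0 : ℝ), ∫⁻ x, ENNReal.ofReal (weilArchDensity t * F x (x + t)) = 0) :
    ∀ᵐ t : ℝ, t ∈ Ioi (0 : ℝ) → ∫⁻ x, ENNReal.ofReal (F x (x + t)) = 0 := by
  have hG : Measurable fun p : ℝ × ℝ ↦ ENNReal.ofReal (F p.2 (p.2 + p.1)) := by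
    have : (fun p : ℝ × ℝ ↦ F p.2 (p.2 + p.1)) =
        Function.uncurry F ∘ fun p : ℝ × ℝ ↦ (p.2, p.2 + p.1) := by
      funext p; rfl
    refine ENNReal.measurable_ofReal.comp ?_
    rw [this]
    exact hF.comp (measurable_snd.prodMk (measurable_snd.add measurable_fst))
  have hinner : ∀ t, ∫⁻ x, ENNReal.ofReal (weilArchDensity t * F x (x + t)) =
      ENNReal.ofReal (weilArchDensity t) * ∫⁻ x, ENNReal.ofReal (F x (x + t)) := by
    intro t
    have hm' : Measurable fun x : ℝ ↦ ENNReal.ofReal (F x (x + t)) :=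
      hG.comp (measurable_const.prodMk measurable_id)
    rw [← lintegral_const_mul _ hm']
    refine lintegral_congr fun x ↦ ?_
    by_cases ht : 0 ≤ weilArchDensity t
    · rw [ENNReal.ofReal_mul ht]
    · rw [not_le] at ht
      rw [ENNReal.ofReal_of_nonpos (mul_nonpos_of_nonpos_of_nonneg ht.le (hF0 _ _)),
        ENNReal.ofReal_of_nonpos ht.le, zero_mul]
  simp_rw [hinner] at h
  have hm : Measurable fun t : ℝ ↦
      ENNReal.ofReal (weilArchDensity t) * ∫⁻ x, ENNReal.ofReal (F x (x + t)) := by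
    exact (ENNReal.measurable_ofReal.comp measurable_weilArchDensity).mul
      hG.lintegral_prod_right'
  have hae := (lintegral_eq_zero_iff hm).1 h
  rw [Filter.EventuallyEq, ae_restrict_iff' measurableSet_Ioi] at hae
  filter_upwards [hae] with t ht hpos
  have h1 := ht hpos
  simp only [Pi.zero_apply, mul_eq_zero] at h1
  rcases h1 with h1 | h1
  · exact absurd h1 (ENNReal.ofReal_pos.2 (weilArchDensity_pos hpos)).ne'
  · exact h1

/-! ## The energy deficit identity -/

/-- **Integrated pointwise identity.** If `|M(y) − M(x)|² + F(x, y) = w₀|Φ₀(y) − Φ₀(x)|² +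
w₁|Φ₁(y) − Φ₁(x)|²` pointwise and `M, Φ₀, Φ₁ ∈ L²`, then for every jump
length `t` the deficit `x ↦ F(x, x + t)` is integrable and
`D_t(M) + ∫ F(x, x+t) dx = w₀ D_t(Φ₀) + w₁ D_t(Φ₁)`. -/
theorem weilIncrement_add_integral_deficit {M Φ₀ Φ₁ : ℝ → ℂ} {w₀ w₁ : ℝ}
    (hM : MemLp M 2) (hΦ₀ : MemLp Φ₀ 2) (hΦ₁ : MemLp Φ₁ 2) {F : ℝ → ℝ → ℝ}
    (hid : ∀ x y, ‖M y - M x‖ ^ 2 + F x y = w₀ * ‖Φ₀ y - Φ₀ x‖ ^ 2 + w₁ * ‖Φ₁ y - Φ₁ x‖ ^ 2)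
    (t : ℝ) :
    Integrable (fun x ↦ F x (x + t)) ∧
      weilIncrement M t + ∫ x, F x (x + t) =
        w₀ * weilIncrement Φ₀ t + w₁ * weilIncrement Φ₁ t := by
  have hIM := integrable_weilIncrement_integrand hM t
  have hI₀ := integrable_weilIncrement_integrand hΦ₀ t
  have hI₁ := integrable_weilIncrement_integrand hΦ₁ t
  have hR : Integrable fun x ↦ w₀ * ‖Φ₀ (x + t) - Φ₀ x‖ ^ 2 + w₁ * ‖Φ₁ (x + t) - Φ₁ x‖ ^ 2 :=
    (hI₀.const_mul w₀).add (hI₁.const_mul w₁)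
  have hFt_eq : (fun x ↦ F x (x + t)) = fun x ↦
      (w₀ * ‖Φ₀ (x + t) - Φ₀ x‖ ^ 2 + w₁ * ‖Φ₁ (x + t) - Φ₁ x‖ ^ 2) - ‖M (x + t) - M x‖ ^ 2 := by
    funext x
    have := hid x (x + t)
    linarith
  have hFt : Integrable fun x ↦ F x (x + t) := by
    rw [hFt_eq]
    exact hR.sub hIM
  refine ⟨hFt, ?_⟩
  unfold weilIncrement
  rw [← integral_add hIM hFt, ← integral_const_mul, ← integral_const_mul,
    ← integral_add (hI₀.const_mul w₀) (hI₁.const_mul w₁)]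
  exact integral_congr_ae (Eventually.of_forall fun x ↦ hid x (x + t))

/-- **The energy deficit.** Under the pointwise identity of `weilIncrement_add_integral_deficit`
with `F ≥ 0` and `Φ₀, Φ₁` of finite archimedean energy: `M` has finite archimedean
energy, and the weighted deficit is bounded by the energy gap,
`∫⁻_{t>0} ∫⁻ ofReal(ρ(t) F(x, x+t)) dx dt ≤ ofReal(w₀ 𝓔_a(Φ₀) + w₁ 𝓔_a(Φ₁) − 𝓔_a(M))`
(the prime lengths only add non-negative deficits `Λ(n)n^{-1/2} ∫ F(x, x + log n) dx`, which are
dropped). -/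
theorem lintegral_deficit_le {a : ℝ} {M Φ₀ Φ₁ : ℝ → ℂ} {w₀ w₁ : ℝ}
    (hM : MemLp M 2) (hΦ₀ : MemLp Φ₀ 2) (hΦ₁ : MemLp Φ₁ 2)
    {F : ℝ → ℝ → ℝ} (hF0 : ∀ x y, 0 ≤ F x y)
    (hid : ∀ x y, ‖M y - M x‖ ^ 2 + F x y = w₀ * ‖Φ₀ y - Φ₀ x‖ ^ 2 + w₁ * ‖Φ₁ y - Φ₁ x‖ ^ 2)
    (hfin₀ : IntegrableOn (fun t ↦ weilArchDensity t * weilIncrement Φ₀ t) (Ioi 0))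
    (hfin₁ : IntegrableOn (fun t ↦ weilArchDensity t * weilIncrement Φ₁ t) (Ioi 0)) :
    IntegrableOn (fun t ↦ weilArchDensity t * weilIncrement M t) (Ioi 0) ∧
      ∫⁻ t in Ioi (0 : ℝ), ∫⁻ x, ENNReal.ofReal (weilArchDensity t * F x (x + t)) ≤
        ENNReal.ofReal (w₀ * weilDirichletEnergy a Φ₀ + w₁ * weilDirichletEnergy a Φ₁ -
          weilDirichletEnergy a M) := by
  have hstep := fun t ↦ weilIncrement_add_integral_deficit hM hΦ₀ hΦ₁ hid t
  -- the deficit at length `t`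
  set R : ℝ → ℝ := fun t ↦ ∫ x, F x (x + t) with hRdef
  have hR0 : ∀ t, 0 ≤ R t := fun t ↦ integral_nonneg fun x ↦ hF0 _ _
  have hReq : ∀ t, R t = w₀ * weilIncrement Φ₀ t + w₁ * weilIncrement Φ₁ t - weilIncrement M t :=
    fun t ↦ by have := (hstep t).2; simp only [hRdef]; linarith
  have hD : ∀ t, weilIncrement M t ≤ w₀ * weilIncrement Φ₀ t + w₁ * weilIncrement Φ₁ t :=
    fun t ↦ by linarith [hR0 t, hReq t]
  -- measurability
  have hMm : AEStronglyMeasurable (fun t ↦ weilArchDensity t * weilIncrement M t)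
      (volume.restrict (Ioi 0)) :=
    (measurable_weilArchDensity.aestronglyMeasurable.mul
      (stub_localizedCut_aesm_weilIncrement hM.1)).restrict
  -- finite archimedean energy of `M`
  have hdom : IntegrableOn (fun t ↦ w₀ * (weilArchDensity t * weilIncrement Φ₀ t) +
      w₁ * (weilArchDensity t * weilIncrement Φ₁ t)) (Ioi 0) :=
    (hfin₀.const_mul w₀).add (hfin₁.const_mul w₁)
  have hfinM : IntegrableOn (fun t ↦ weilArchDensity t * weilIncrement M t) (Ioi 0) := by
    refine Integrable.mono' hdom hMm ?_
    refine (ae_restrict_iff' measurableSet_Ioi).2 (Eventually.of_forall fun t (ht : 0 < t) ↦ ?_)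
    have hρ := (weilArchDensity_pos ht).le
    rw [Real.norm_of_nonneg (mul_nonneg hρ (weilIncrement_nonneg M t))]
    have := mul_le_mul_of_nonneg_left (hD t) hρ
    linarith [this]
  refine ⟨hfinM, ?_⟩
  -- the weighted deficit is integrable with integral `≤` the energy gap
  have hρR : IntegrableOn (fun t ↦ weilArchDensity t * R t) (Ioi 0) := by
    have h := hdom.sub hfinM
    refine h.congr (Eventually.of_forall fun t ↦ ?_)
    simp only [Pi.sub_apply, hReq]
    ring
  have hρR_int : ∫ t in Ioi (0 : ℝ), weilArchDensity t * R t =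
      w₀ * (∫ t in Ioi (0 : ℝ), weilArchDensity t * weilIncrement Φ₀ t) +
        w₁ * (∫ t in Ioi (0 : ℝ), weilArchDensity t * weilIncrement Φ₁ t) -
        ∫ t in Ioi (0 : ℝ), weilArchDensity t * weilIncrement M t := by
    rw [← integral_const_mul, ← integral_const_mul, ← integral_add (hfin₀.const_mul w₀)
      (hfin₁.const_mul w₁), ← integral_sub hdom hfinM]
    refine integral_congr_ae (Eventually.of_forall fun t ↦ ?_)
    simp only [hReq]
    ring
  have hprime : (∑ n ∈ weilPrimeIndex a, (Λ n : ℝ) / Real.sqrt n * weilIncrement M (Real.log n)) ≤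
      w₀ * (∑ n ∈ weilPrimeIndex a, (Λ n : ℝ) / Real.sqrt n * weilIncrement Φ₀ (Real.log n)) +
        w₁ * (∑ n ∈ weilPrimeIndex a, (Λ n : ℝ) / Real.sqrt n * weilIncrement Φ₁ (Real.log n)) := by
    rw [Finset.mul_sum, Finset.mul_sum, ← Finset.sum_add_distrib]
    refine Finset.sum_le_sum fun n _ ↦ ?_
    have hc : 0 ≤ (Λ n : ℝ) / Real.sqrt n :=
      div_nonneg ArithmeticFunction.vonMangoldt_nonneg (Real.sqrt_nonneg _)
    have := mul_le_mul_of_nonneg_left (hD (Real.log n)) hc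
    linarith [this]
  have hgap : ∫ t in Ioi (0 : ℝ), weilArchDensity t * R t ≤
      w₀ * weilDirichletEnergy a Φ₀ + w₁ * weilDirichletEnergy a Φ₁ - weilDirichletEnergy a M := by
    rw [hρR_int]
    unfold weilDirichletEnergy
    linarith [hprime]
  -- convert to lower Lebesgue integrals
  have hinner : ∀ t ∈ Ioi (0 : ℝ), ∫⁻ x, ENNReal.ofReal (weilArchDensity t * F x (x + t)) =
      ENNReal.ofReal (weilArchDensity t * R t) := by
    intro t ht
    have hρ := (weilArchDensity_pos ht).le
    rw [hRdef]
    simp only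
    rw [← integral_const_mul, ofReal_integral_eq_lintegral_ofReal ((hstep t).1.const_mul _)
      (Eventually.of_forall fun x ↦ mul_nonneg hρ (hF0 _ _))]
  rw [setLIntegral_congr_fun measurableSet_Ioi hinner,
    ← ofReal_integral_eq_lintegral_ofReal hρR ((ae_restrict_iff' measurableSet_Ioi).2
      (Eventually.of_forall fun t (ht : 0 < t) ↦
        mul_nonneg (weilArchDensity_pos ht).le (hR0 t)))]
  exact ENNReal.ofReal_le_ofReal hgap

end Summit.RiemannHypothesis.RiemannHypothesis.Theorems.WeilGroundStateMarkovPart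

end
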